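import Summits.Ventures.PercRepro0.ZeroOne
import Summits.Ventures.PercRepro0.Independence
import Summits.Ventures.PercRepro0.DualMap

/-!
# P1 · HARRIS (Zhang's argument), part A: the arm events on `Defs.lean`

Cell pub-perc-repro0, seat p2 (gen-1 plan §3 p2 item (3)(b)).  The objects of P1-harris-p1-v1 §1–§2 and
§5 in Defs terms, in the ψ-coordinates of p1's `DualMap` (dual vertex `(x+½, y+½) ↦ (y+1, x)`, so that
open dual paths are paths of `openGraph 2 (dualConfig ω)`):

* geometry: `boxPlusBonds n` (= `E_n^+`), the corner-free primal sides `leftSide/rightSide/topSide/botSide n`,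
  the dual sides `topDual/botDual/leftDual/rightDual n` (= ψ of `T*_n, B*_n, L*_n, R*_n`, corners included),
  `dualBox M` (= ψ(Λ*_M)), `dualBoundary M` (= ψ(∂Λ*_M)), `dualBoxBonds n` (= ψ̂(E(Λ*_n)) = ψ̂((E_n^+)*));
* the one-step relations `OffAdj n ω` (open bond off `E_n^+`), `InAdj N ω` (open bond inside `Λ_N`),
  `DAdj n ω'` (open bond of `ω'` off `dualBoxBonds n`) and `DOffAdj n ω := DAdj n (dualConfig ω)`;
* the arm events `armP S n M`, `armPInf S n`, `armD S n M`, `armDInf S n` and their properties: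
  upper/lower sets (Lemma 1.3), `F_{(E_n^+)ᶜ}`-measurability (Lemma 1.3), antitone in `M` (Lemma 1.3),
  the union lemmas `boxInf_subset_arms` / `dualBoxInf_subset_darms` (Lemma 2.1), and Lemma 1.4
  (`exists_connInf_of_armPInf`);
* `ZhangSeparation` — the combinatorial separation statement (P9-separation-p1-v1 Lemma 4.1 in ψ-coordinates),
  the ONE hypothesis of the skeleton (INBOX 2026-08-26T00:5xZ interface line).
-/

open MeasureTheory ProbabilityTheory unitInterval
open scoped ENNReal Topology

namespace Summit.Ventures.PercRepro0.Zhang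

open Summit.Ventures.PercRepro0.Defs Summit.Ventures.PercRepro0.L2 Summit.Ventures.PercRepro0.DualMap
  Summit.Ventures.PercRepro0.Crossing

-- BEGIN BODY

open Summit.Ventures.PercRepro0.L2 Summit.Ventures.PercRepro0.DualMap Summit.Ventures.PercRepro0.Crossing

/-! ### Geometry -/

/-- `E_n^+`: the bonds with at least one endpoint in `Λ_n`. -/
def boxPlusBonds (n : ℕ) : Set (Sym2 (Vertex 2)) := {e | e ∈ bonds 2 ∧ ∃ v ∈ e, v ∈ box 2 n}

/-- The left side `L_n = {(−n−1, j) : |j| ≤ n}` of the ring `Λ_{n+1} ∖ Λ_n` (corners excluded). -/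
def leftSide (n : ℕ) : Set (Vertex 2) := {x | x 0 = -((n : ℤ) + 1) ∧ |x 1| ≤ n}

/-- The right side `R_n`. -/
def rightSide (n : ℕ) : Set (Vertex 2) := {x | x 0 = (n : ℤ) + 1 ∧ |x 1| ≤ n}

/-- The top side `T_n`. -/
def topSide (n : ℕ) : Set (Vertex 2) := {x | x 1 = (n : ℤ) + 1 ∧ |x 0| ≤ n}

/-- The bottom side `Bo_n`. -/
def botSide (n : ℕ) : Set (Vertex 2) := {x | x 1 = -((n : ℤ) + 1) ∧ |x 0| ≤ n}

/-- The "dual norm" `dn x = max(|x₀ − ½|, |x₁ + ½|) − ½ ∈ ℤ` in ψ-coordinates: `dualBox M = {dn ≤ M}`. -/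
def dn (x : Vertex 2) : ℤ := max (max (x 0 - 1) (-(x 0))) (max (x 1) (-(x 1) - 1))

/-- `ψ(Λ*_M) = {x : −M ≤ x₀ ≤ M+1, −M−1 ≤ x₁ ≤ M}`. -/
def dualBox (M : ℕ) : Set (Vertex 2) := {x | dn x ≤ M}

/-- `ψ(∂Λ*_M) = {dn x = M}`. -/
def dualBoundary (M : ℕ) : Set (Vertex 2) := {x | dn x = M}

/-- `ψ̂(E(Λ*_n))`: the bonds with both endpoints in `dualBox n`. -/
def dualBoxBonds (n : ℕ) : Set (Sym2 (Vertex 2)) := {e | ∀ v ∈ e, v ∈ dualBox n}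

/-- `ψ(T*_n) = {(n+1, i) : −n−1 ≤ i ≤ n}`. -/
def topDual (n : ℕ) : Set (Vertex 2) := {x | x 0 = (n : ℤ) + 1 ∧ -((n : ℤ) + 1) ≤ x 1 ∧ x 1 ≤ n}

/-- `ψ(B*_n) = {(−n, i) : −n−1 ≤ i ≤ n}`. -/
def botDual (n : ℕ) : Set (Vertex 2) := {x | x 0 = -(n : ℤ) ∧ -((n : ℤ) + 1) ≤ x 1 ∧ x 1 ≤ n}

/-- `ψ(L*_n) = {(j+1, −n−1) : −n−1 ≤ j ≤ n}`. -/
def leftDual (n : ℕ) : Set (Vertex 2) := {x | x 1 = -((n : ℤ) + 1) ∧ -(n : ℤ) ≤ x 0 ∧ x 0 ≤ n + 1}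

/-- `ψ(R*_n) = {(j+1, n) : −n−1 ≤ j ≤ n}`. -/
def rightDual (n : ℕ) : Set (Vertex 2) := {x | x 1 = n ∧ -(n : ℤ) ≤ x 0 ∧ x 0 ≤ n + 1}

/-! ### One-step relations and arm events -/

/-- An open bond of `ω` not in `E_n^+`. -/
def OffAdj (n : ℕ) (ω : Config 2) (x y : Vertex 2) : Prop :=
  (lattice 2).Adj x y ∧ s(x, y) ∈ ω ∧ s(x, y) ∉ boxPlusBonds n

/-- An open bond of `ω` with both endpoints in `Λ_N`. -/
def InAdj (N : ℕ) (ω : Config 2) (x y : Vertex 2) : Prop :=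
  (lattice 2).Adj x y ∧ s(x, y) ∈ ω ∧ x ∈ box 2 N ∧ y ∈ box 2 N

/-- An open bond of `ω'` not in `dualBoxBonds n` (`ω'` plays the role of a dual configuration). -/
def DAdj (n : ℕ) (ω' : Config 2) (x y : Vertex 2) : Prop :=
  (lattice 2).Adj x y ∧ s(x, y) ∈ ω' ∧ s(x, y) ∉ dualBoxBonds n

/-- An open dual bond of `ω` (a bond of `dualConfig ω`) not in `dualBoxBonds n`. -/
def DOffAdj (n : ℕ) (ω : Config 2) (x y : Vertex 2) : Prop := DAdj n (dualConfig ω) x y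

/-- The primal arm event `A^S_{n,M}`: some `u ∈ S` is joined to `∂Λ_M` by an open path using no bond of `E_n^+`. -/
def armP (S : Set (Vertex 2)) (n M : ℕ) : Set (Config 2) :=
  {ω | ∃ u ∈ S, ∃ y ∈ boundary 2 M, Relation.ReflTransGen (OffAdj n ω) u y}

/-- The limit primal arm event `A^S_n = ⋂_{M ≥ n+2} A^S_{n,M}`. -/
def armPInf (S : Set (Vertex 2)) (n : ℕ) : Set (Config 2) :=
  ⋂ M : ℕ, ⋂ (_ : n + 2 ≤ M), armP S n M

/-- The dual arm event in ψ-coordinates, for a configuration `ω'` playing the dual: some `t ∈ S` is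
joined to `ψ(∂Λ*_M)` by an `ω'`-open path using no bond of `dualBoxBonds n`. -/
def darm (S : Set (Vertex 2)) (n M : ℕ) : Set (Config 2) :=
  {ω' | ∃ t ∈ S, ∃ y ∈ dualBoundary M, Relation.ReflTransGen (DAdj n ω') t y}

/-- The dual arm event `A*^{S*}_{n,M}` of `ω`: `darm` of its dual configuration. -/
def armD (S : Set (Vertex 2)) (n M : ℕ) : Set (Config 2) := dualConfig ⁻¹' darm S n M

/-- The limit dual arm event `A*^{S*}_n`. -/
def armDInf (S : Set (Vertex 2)) (n : ℕ) : Set (Config 2) :=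
  ⋂ M : ℕ, ⋂ (_ : n + 2 ≤ M), armD S n M

/-- ZHANG SEPARATION (P9-separation-p1-v1 Lemma 4.1 in ψ-coordinates): for `n ≥ 1`, `N ≥ n+2` and any
configuration `ω`, the four statements cannot all hold — (Z) every bond of `E_n^+` is closed;
(Γ) an open path inside `Λ_{N−1}` joins `L_n` to `R_n`; (T) an open dual path from `ψ(T*_n)` reaches
`ψ(∂Λ*_N)` using no bond of `ψ̂(E(Λ*_n))`; (B) the same from `ψ(B*_n)`.  THE hypothesis of the skeleton. -/
def ZhangSeparation : Prop :=
  ∀ (n N : ℕ) (ω : Config 2), 1 ≤ n → n + 2 ≤ N →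
    (∀ e ∈ boxPlusBonds n, e ∉ ω) →
    (∃ vL ∈ leftSide n, ∃ vR ∈ rightSide n, Relation.ReflTransGen (InAdj (N - 1) ω) vL vR) →
    (∃ t ∈ topDual n, ∃ y ∈ dualBoundary N, Relation.ReflTransGen (DOffAdj n ω) t y) →
    (∃ b ∈ botDual n, ∃ y ∈ dualBoundary N, Relation.ReflTransGen (DOffAdj n ω) b y) → False

/-! ### Generic path lemmas -/

/-- First-exit lemma for any relation along which a `ℤ`-valued "norm" grows by at most one. -/
lemma exists_level {R : Vertex 2 → Vertex 2 → Prop} {f : Vertex 2 → ℤ}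
    (hf : ∀ x y, R x y → f y ≤ f x + 1) {u y : Vertex 2} (h : Relation.ReflTransGen R u y)
    {m : ℤ} (hu : f u ≤ m) (hy : m ≤ f y) : ∃ z, f z = m ∧ Relation.ReflTransGen R u z := by
  have key : ∀ z, Relation.ReflTransGen R u z →
      (f z ≤ m ∧ Relation.ReflTransGen R u z) ∨ ∃ z', f z' = m ∧ Relation.ReflTransGen R u z' := by
    intro z hz
    induction hz with
    | refl => exact Or.inl ⟨hu, Relation.ReflTransGen.refl⟩
    | @tail z' z _ hadj ih =>
      rcases ih with ⟨hz', hc⟩ | hw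
      · by_cases hzm : f z ≤ m
        · exact Or.inl ⟨hzm, hc.tail hadj⟩
        · have := hf _ _ hadj
          exact Or.inr ⟨z', by omega, hc⟩
      · exact Or.inr hw
  rcases key y h with ⟨hym, hc⟩ | hw
  · exact ⟨y, le_antisymm hym hy, hc⟩
  · exact hw

/-- Exit lemma (last exit): a path from inside `B` to outside `B` has a suffix that starts in `B` and
whose every later vertex lies outside `B`. -/
lemma exists_exit {R : Vertex 2 → Vertex 2 → Prop} {B : Set (Vertex 2)} {x y : Vertex 2}
    (h : Relation.ReflTransGen R x y) (hx : x ∈ B) (hy : y ∉ B) :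
    ∃ t ∈ B, Relation.ReflTransGen (fun a b => R a b ∧ b ∉ B) t y := by
  induction h with
  | refl => exact absurd hx hy
  | @tail z y _ hzy ih =>
    by_cases hz : z ∈ B
    · exact ⟨z, hz, Relation.ReflTransGen.single ⟨hzy, hy⟩⟩
    · obtain ⟨t, ht, hpath⟩ := ih hz
      exact ⟨t, ht, hpath.tail ⟨hzy, hy⟩⟩

/-- A path for the relation «`R` and the target is outside `B`» that starts outside `B` stays outside `B`. -/
lemma reflTransGen_off_of_start {R : Vertex 2 → Vertex 2 → Prop} {B : Set (Vertex 2)} {u z : Vertex 2}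
    (hu : u ∉ B) (h : Relation.ReflTransGen (fun a b => R a b ∧ b ∉ B) u z) :
    Relation.ReflTransGen (fun a b => R a b ∧ a ∉ B ∧ b ∉ B) u z ∧ z ∉ B := by
  induction h with
  | refl => exact ⟨Relation.ReflTransGen.refl, hu⟩
  | tail _ hab ih => exact ⟨ih.1.tail ⟨hab.1, ih.2, hab.2⟩, hab.2⟩

/-- Exit lemma, primal form: the path leaves `B` along one step `t → u` and then stays outside `B`. -/
lemma exists_exit' {R : Vertex 2 → Vertex 2 → Prop} {B : Set (Vertex 2)} {x y : Vertex 2}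
    (h : Relation.ReflTransGen R x y) (hx : x ∈ B) (hy : y ∉ B) :
    ∃ t ∈ B, ∃ u ∉ B, R t u ∧ Relation.ReflTransGen (fun a b => R a b ∧ a ∉ B ∧ b ∉ B) u y := by
  obtain ⟨t, ht, hpath⟩ := exists_exit h hx hy
  rcases hpath.cases_head with rfl | ⟨u, hu, hrest⟩
  · exact absurd ht hy
  · exact ⟨t, ht, u, hu.2, hu.1, (reflTransGen_off_of_start hu.2 hrest).1⟩

/-- Monotonicity of reflexive–transitive closures in the relation. -/
lemma reflTransGen_mono {α : Type*} {R R' : α → α → Prop} (h : ∀ a b, R a b → R' a b) {x y : α}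
    (hxy : Relation.ReflTransGen R x y) : Relation.ReflTransGen R' x y := by
  induction hxy with
  | refl => exact Relation.ReflTransGen.refl
  | tail _ hab ih => exact ih.tail (h _ _ hab)

/-! ### Lemma 1.3(a)(b): monotonicity and measurability of the arm events -/

/-- `armP S n M` is an increasing event. -/
lemma isUpperSet_armP (S : Set (Vertex 2)) (n M : ℕ) : IsUpperSet (armP S n M) := by
  rintro ω ω' h ⟨u, hu, y, hy, hpath⟩
  exact ⟨u, hu, y, hy, reflTransGen_mono (fun a b hab => ⟨hab.1, h hab.2.1, hab.2.2⟩) hpath⟩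

/-- `darm S n M` is an increasing event (in the dual configuration). -/
lemma isUpperSet_darm (S : Set (Vertex 2)) (n M : ℕ) : IsUpperSet (darm S n M) := by
  rintro ω ω' h ⟨t, ht, y, hy, hpath⟩
  exact ⟨t, ht, y, hy, reflTransGen_mono (fun a b hab => ⟨hab.1, h hab.2.1, hab.2.2⟩) hpath⟩

/-- The dual configuration is antitone. -/
lemma dualConfig_antitone {ω ω' : Config 2} (h : ω ⊆ ω') : dualConfig ω' ⊆ dualConfig ω := by
  intro e he
  rw [mem_dualConfig] at he ⊢
  exact ⟨he.1, fun h' => he.2 (h h')⟩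

/-- `armD S n M` is a decreasing event. -/
lemma isLowerSet_armD (S : Set (Vertex 2)) (n M : ℕ) : IsLowerSet (armD S n M) :=
  fun _ _ h hω => isUpperSet_darm S n M (dualConfig_antitone h) hω

/-- `armPInf S n` is an increasing event. -/
lemma isUpperSet_armPInf (S : Set (Vertex 2)) (n : ℕ) : IsUpperSet (armPInf S n) :=
  isUpperSet_iInter fun M => isUpperSet_iInter fun _ => isUpperSet_armP S n M

/-- `armDInf S n` is a decreasing event. -/
lemma isLowerSet_armDInf (S : Set (Vertex 2)) (n : ℕ) : IsLowerSet (armDInf S n) :=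
  isLowerSet_iInter fun M => isLowerSet_iInter fun _ => isLowerSet_armD S n M

/-- The one-step event `{ω | OffAdj n ω x y}` is `F_{(E_n^+)ᶜ}`-measurable. -/
lemma measurableSet_offAdj_sigmaOn (n : ℕ) (x y : Vertex 2) :
    MeasurableSet[sigmaOn (boxPlusBonds n)ᶜ] {ω : Config 2 | OffAdj n ω x y} := by
  by_cases h : (lattice 2).Adj x y ∧ s(x, y) ∉ boxPlusBonds n
  · have : {ω : Config 2 | OffAdj n ω x y} = {ω | s(x, y) ∈ ω} := by
      ext ω; simp [OffAdj, h.1, h.2]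
    rw [this]
    exact measurableSet_sigmaOn_mem (E := (boxPlusBonds n)ᶜ) h.2
  · have : {ω : Config 2 | OffAdj n ω x y} = ∅ := by
      ext ω
      simp only [OffAdj, Set.mem_setOf_eq, Set.mem_empty_iff_false, iff_false]
      intro hω
      exact h ⟨hω.1, hω.2.2⟩
    rw [this]
    exact @MeasurableSet.empty _ (sigmaOn (boxPlusBonds n)ᶜ)

/-- `armP S n M` is `F_{(E_n^+)ᶜ}`-measurable. -/
lemma measurableSet_armP_sigmaOn (S : Set (Vertex 2)) (n M : ℕ) :
    MeasurableSet[sigmaOn (boxPlusBonds n)ᶜ] (armP S n M) := by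
  have : armP S n M = ⋃ u ∈ S, ⋃ y ∈ boundary 2 M,
      {ω : Config 2 | Relation.ReflTransGen (OffAdj n ω) u y} := by
    ext ω; simp [armP]
  rw [this]
  refine MeasurableSet.biUnion S.to_countable fun u _ =>
    MeasurableSet.biUnion (Set.to_countable _) fun y _ => ?_
  exact @measurableSet_reflTransGen (Vertex 2) _ (Config 2) (sigmaOn (boxPlusBonds n)ᶜ)
    (fun ω => OffAdj n ω) (measurableSet_offAdj_sigmaOn n) u y

/-- `armP S n M` is measurable. -/
lemma measurableSet_armP (S : Set (Vertex 2)) (n M : ℕ) : MeasurableSet (armP S n M) :=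
  (sigmaOn_le _) _ (measurableSet_armP_sigmaOn S n M)

/-- `armPInf S n` is `F_{(E_n^+)ᶜ}`-measurable. -/
lemma measurableSet_armPInf_sigmaOn (S : Set (Vertex 2)) (n : ℕ) :
    MeasurableSet[sigmaOn (boxPlusBonds n)ᶜ] (armPInf S n) :=
  MeasurableSet.iInter fun M => MeasurableSet.iInter fun _ => measurableSet_armP_sigmaOn S n M

/-- `armPInf S n` is measurable. -/
lemma measurableSet_armPInf (S : Set (Vertex 2)) (n : ℕ) : MeasurableSet (armPInf S n) :=
  (sigmaOn_le _) _ (measurableSet_armPInf_sigmaOn S n)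

/-! ### The geometry of `τ`: `ψ̂(E(Λ*_n)) = τ(E_n^+)` (P8 Lemma 3.2 in ψ-coordinates) -/

/-- Membership of a pair in `E_n^+`, in coordinates. -/
lemma pair_mem_boxPlusBonds {n : ℕ} {x y : Vertex 2} (hb : s(x, y) ∈ bonds 2) :
    s(x, y) ∈ boxPlusBonds n ↔ x ∈ box 2 n ∨ y ∈ box 2 n := by
  simp only [boxPlusBonds, Set.mem_setOf_eq, hb, true_and, Sym2.mem_iff]
  constructor
  · rintro ⟨v, hv | hv, hvb⟩
    · exact Or.inl (hv ▸ hvb)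
    · exact Or.inr (hv ▸ hvb)
  · rintro (h | h)
    · exact ⟨x, Or.inl rfl, h⟩
    · exact ⟨y, Or.inr rfl, h⟩

/-- Membership of a pair in `dualBoxBonds n`, in coordinates. -/
lemma pair_mem_dualBoxBonds {n : ℕ} {x y : Vertex 2} :
    s(x, y) ∈ dualBoxBonds n ↔ x ∈ dualBox n ∧ y ∈ dualBox n := by
  simp only [dualBoxBonds, Set.mem_setOf_eq, Sym2.mem_iff]
  constructor
  · intro h; exact ⟨h x (Or.inl rfl), h y (Or.inr rfl)⟩
  · rintro ⟨hx, hy⟩ v (rfl | rfl)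
    · exact hx
    · exact hy

/-- `x ∈ Λ_n` in coordinates (`d = 2`). -/
lemma mem_box_two {n : ℕ} {x : Vertex 2} : x ∈ box 2 n ↔ |x 0| ≤ n ∧ |x 1| ≤ n := by
  simp only [box, Set.mem_setOf_eq, Fin.forall_fin_two]

/-- `x ∈ dualBox n` in coordinates. -/
lemma mem_dualBox {n : ℕ} {x : Vertex 2} :
    x ∈ dualBox n ↔ -(n : ℤ) ≤ x 0 ∧ x 0 ≤ n + 1 ∧ -((n : ℤ) + 1) ≤ x 1 ∧ x 1 ≤ n := by
  simp only [dualBox, dn, Set.mem_setOf_eq, max_le_iff]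
  omega

/-- The key coordinate fact: a bond lies in `ψ̂(E(Λ*_n))` iff its `τ`-image lies in `E_n^+`
(P8 Lemma 3.2: `(E_n^+)* = E(Λ*_n)`). -/
lemma dualEdge_mem_boxPlusBonds_iff {n : ℕ} {e : Sym2 (Vertex 2)} (he : e ∈ bonds 2) :
    dualEdge e ∈ boxPlusBonds n ↔ e ∈ dualBoxBonds n := by
  obtain ⟨i, j, rfl | rfl⟩ := bond_cases e he
  · rw [dualEdge_h, pair_mem_boxPlusBonds (h_mem_bonds j i), pair_mem_dualBoxBonds,
      mem_box_two, mem_box_two, mem_dualBox, mem_dualBox]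
    simp only [pt_zero, pt_one, abs_le]
    omega
  · rw [dualEdge_v, pair_mem_boxPlusBonds (by
        have := v_mem_bonds (j + 1) (i - 1)
        simpa using this), pair_mem_dualBoxBonds, mem_box_two, mem_box_two, mem_dualBox, mem_dualBox]
    simp only [pt_zero, pt_one, abs_le]
    omega

/-- The one-step event `{ω | DOffAdj n ω x y}` is `F_{(E_n^+)ᶜ}`-measurable. -/
lemma measurableSet_dOffAdj_sigmaOn (n : ℕ) (x y : Vertex 2) :
    MeasurableSet[sigmaOn (boxPlusBonds n)ᶜ] {ω : Config 2 | DOffAdj n ω x y} := by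
  by_cases h : (lattice 2).Adj x y ∧ s(x, y) ∉ dualBoxBonds n
  · have hb : s(x, y) ∈ bonds 2 := (SimpleGraph.mem_edgeSet (lattice 2)).2 h.1
    have hτb : dualEdge s(x, y) ∈ bonds 2 := dualEdge_mem_bonds_of_mem hb
    have hτ : dualEdge s(x, y) ∉ boxPlusBonds n := fun hmem =>
      h.2 ((dualEdge_mem_boxPlusBonds_iff hb).1 hmem)
    have : {ω : Config 2 | DOffAdj n ω x y} = {ω | dualEdge s(x, y) ∈ ω}ᶜ := by
      ext ω
      simp only [DOffAdj, DAdj, Set.mem_setOf_eq, h.1, h.2, true_and, not_false_eq_true, and_true,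
        mem_dualConfig, hτb, Set.mem_compl_iff]
    rw [this]
    exact (measurableSet_sigmaOn_mem (E := (boxPlusBonds n)ᶜ) hτ).compl
  · have : {ω : Config 2 | DOffAdj n ω x y} = ∅ := by
      ext ω
      simp only [DOffAdj, DAdj, Set.mem_setOf_eq, Set.mem_empty_iff_false, iff_false]
      intro hω
      exact h ⟨hω.1, hω.2.2⟩
    rw [this]
    exact @MeasurableSet.empty _ (sigmaOn (boxPlusBonds n)ᶜ)

/-- Membership in `armD`. -/
lemma mem_armD {S : Set (Vertex 2)} {n M : ℕ} {ω : Config 2} :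
    ω ∈ armD S n M ↔ ∃ t ∈ S, ∃ y ∈ dualBoundary M, Relation.ReflTransGen (DOffAdj n ω) t y :=
  Iff.rfl

/-- `armD S n M` is `F_{(E_n^+)ᶜ}`-measurable. -/
lemma measurableSet_armD_sigmaOn (S : Set (Vertex 2)) (n M : ℕ) :
    MeasurableSet[sigmaOn (boxPlusBonds n)ᶜ] (armD S n M) := by
  have : armD S n M = ⋃ t ∈ S, ⋃ y ∈ dualBoundary M,
      {ω : Config 2 | Relation.ReflTransGen (DOffAdj n ω) t y} := by
    ext ω
    simp only [Set.mem_iUnion, Set.mem_setOf_eq, exists_prop]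
    exact mem_armD
  rw [this]
  refine MeasurableSet.biUnion S.to_countable fun t _ =>
    MeasurableSet.biUnion (Set.to_countable _) fun y _ => ?_
  exact @measurableSet_reflTransGen (Vertex 2) _ (Config 2) (sigmaOn (boxPlusBonds n)ᶜ)
    (fun ω => DOffAdj n ω) (measurableSet_dOffAdj_sigmaOn n) t y

/-- `armD S n M` is measurable. -/
lemma measurableSet_armD (S : Set (Vertex 2)) (n M : ℕ) : MeasurableSet (armD S n M) :=
  (sigmaOn_le _) _ (measurableSet_armD_sigmaOn S n M)

/-- `armDInf S n` is `F_{(E_n^+)ᶜ}`-measurable. -/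
lemma measurableSet_armDInf_sigmaOn (S : Set (Vertex 2)) (n : ℕ) :
    MeasurableSet[sigmaOn (boxPlusBonds n)ᶜ] (armDInf S n) :=
  MeasurableSet.iInter fun M => MeasurableSet.iInter fun _ => measurableSet_armD_sigmaOn S n M

/-- `armDInf S n` is measurable. -/
lemma measurableSet_armDInf (S : Set (Vertex 2)) (n : ℕ) : MeasurableSet (armDInf S n) :=
  (sigmaOn_le _) _ (measurableSet_armDInf_sigmaOn S n)

/-- `darm S n M` is measurable. -/
lemma measurableSet_darm (S : Set (Vertex 2)) (n M : ℕ) : MeasurableSet (darm S n M) := by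
  have : darm S n M = ⋃ t ∈ S, ⋃ y ∈ dualBoundary M,
      {ω' : Config 2 | Relation.ReflTransGen (DAdj n ω') t y} := by
    ext ω'; simp [darm]
  rw [this]
  refine MeasurableSet.biUnion S.to_countable fun t _ =>
    MeasurableSet.biUnion (Set.to_countable _) fun y _ => ?_
  refine measurableSet_reflTransGen (fun ω' => DAdj n ω') (fun a b => ?_) t y
  by_cases h : (lattice 2).Adj a b ∧ s(a, b) ∉ dualBoxBonds n
  · have : {ω' : Config 2 | DAdj n ω' a b} = {ω' | s(a, b) ∈ ω'} := by
      ext ω'; simp [DAdj, h.1, h.2]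
    rw [this]; exact measurableSet_mem _
  · have : {ω' : Config 2 | DAdj n ω' a b} = ∅ := by
      ext ω'
      simp only [DAdj, Set.mem_setOf_eq, Set.mem_empty_iff_false, iff_false]
      intro hω
      exact h ⟨hω.1, hω.2.2⟩
    rw [this]; exact MeasurableSet.empty

-- END BODY

end Summit.Ventures.PercRepro0.Zhang
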